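import Summits.BirchSwinnertonDyer.BirchSwinnertonDyer.Theorems.AlignedTransportAtTwoMainConjectureOfRankZeroBSDAtTwoHalfDescentTwistZero
import Summits.BirchSwinnertonDyer.BirchSwinnertonDyer.Theorems.AlignedTransportAtTwoMainConjectureOfRankZeroBSDAtTwoHalfDescentAtTwo
import Summits.BirchSwinnertonDyer.BirchSwinnertonDyer.Theorems.AlignedTransportAtTwoMainConjectureOfRankZeroBSDAtTwoTwinValueAnalytic
import HarnessLib

/-!
# Route `AlignedTransportAtTwo`, crux C2 `MainConjectureOfRankZeroBSDAtTwo` (stmt-BirchSwinnertonDyer-22298):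
# THE HALF-DEGREE DESCENT, VI: THE ANALYTIC SIDE — an even-branch lift `G` of `L₂(f, α)` (C2's binder object) is `ι`-stable by the tree's
# functional equation (g49 `iotaStable_of_isEvenBranchLiftAtTwo`, no PRINT binder), so `G = 2^{μ_an}·(T+2)^{k_an}·h_an(γ + γ⁻¹)·w`;
# the analytic layer-2 law; and Mazur's main conjecture on the cell in the coordinates `(μ, k, h)`: `(f_X) = (G) ⟺` ONE common triple

HONEST FRAMING (cell `bsd-f1-sign2`, WIDTH-5 attached prover seat `bsd-line-att-p5` gen 51 on line `birth` of the lead `bsd-line-att-p2`;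
`--supports` stmt-BirchSwinnertonDyer-22298, closes nothing; BSD is NOT proved by any of this; the crux C2, its verdict «blocked-on
`Rank1Residual.GreenbergMuConjectureIrreducible`» and every registered stub are untouched). THEOREMS ONLY — no `def`, no instance, no named fact,
no `sorry`. Sequel of `…HalfDescentTwistZero` (p825139) and `…HalfDescentAtTwo` (p824992); the ANALYTIC `ι`-stability is g49's
`…TwinValueAnalytic.iotaStable_of_isEvenBranchLiftAtTwo` (the conductor-level functional equation `G(T^ι) = w(W)(1+T)^e G`, a tree theorem).
* ★★★ `exists_twistZero_realCounterpart_evenBranchLift`: `W` good at `2`, `f` its conductor-level newform, `G` an even-branch lift with `G(0) ≠ 0`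
  (`= (1−α⁻¹)²[0]⁺_f ≠ 0`, i.e. `L(W,1) ≠ 0` on the ordinary branch) ⟹ **`G = 2^{μ(G)}·(T+2)^k·h_an(γ + γ⁻¹)·w`**, `h_an ∈ ℤ₂[Y]` monic,
  `λ(G) = k + 2·deg h_an` — the analytic invariants `(μ_an, k_an, h_an)`; NO print binder.
* ★★ `layerTwo_law_evenBranchLift`: if moreover `G(−2) ≠ 0` (twin `S₈(f) ≠ 0`), `red G ≠ 0` (`μ_an = 0`) and `ord₂ G(0) = 2` (analytic weight `2`),
  then for `ζ² = −1`: `λ_an = 2 ⟹ ‖G(ζ − 1)‖₂ = 1/2 ∧ 8 ∣ G(−2)`; `λ_an ≥ 4 ⟹ ‖G(ζ − 1)‖₂ ≤ 1/4 ∧ ord₂ G(−2) = 2` — by MTT interpolation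
  `‖G(ζ₄ − 1)‖₂` is the conductor-`16` Birch-sum value of `…LayerValueAnalytic`, so this is a falsifiable ENGINE-T prediction: on `μ_an = 0`, analytic
  weight-2 rows the conductor-16 valuation is decided by `λ_an` (`= 2 ⟺` boundary; `≥ 4 ⟺` at least one full step past it).
* ★★ `span_eq_span_iff_exists_common_description`: for `ι`-stable `F₁, F₂ ∈ Λ ∖ {0}` with `F₁(0) ≠ 0`: **`(F₁) = (F₂) ⟺ ∃` ONE triple `(μ, k, h)`,
  `h` monic, and units `w₁, w₂` with `F_i = p^μ (T+2)^k h(γ+γ⁻¹) w_i`** — Mazur's main conjecture `(f_X) = (ϖ·L₂)` on the cell is the identity of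
  the algebraic and analytic triples (uniqueness of each triple: `…HalfDescentTwistZero.realCounterpart_unique_of_twistZero`, `k = ord_{−2}`).
BSD is not proved by any of this; nothing is closed. Memo `Cruxes/MainConjectureOfRankZeroBSDAtTwo/HALF-DESCENT-att-p5-g51.md`.

References: B. Mazur, J. Tate, J. Teitelbaum, Invent. Math. 84 (1986) Ch. I §14, §17 [MazurTateTeitelbaum1986Invent]; R. Greenberg, LNM 1716 (1999)
§1 pp. 67–68 [GreenbergLNM1716]; L. Washington, GTM 83, §7.1 [Washington1997]; M. Goresky, Y.-S. Tai, arXiv:1701.07742, App. §16.2 Prop. 36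
[GoreskyTai2017RealStructuresOrdinary].
-/

set_option linter.dupNamespace false
set_option autoImplicit false

noncomputable section

open scoped Classical MatrixGroups ModularForm

namespace Summit.BirchSwinnertonDyer.BirchSwinnertonDyer.Theorems.AlignedTransportAtTwoHalfDescentAnalytic

open PowerSeries CongruenceSubgroup WeierstrassCurve Literature.NumberTheory.EllipticCurves
  Literature.NumberTheory.EllipticCurves.IwasawaAlgebra Literature.NumberTheory.EllipticCurves.ModularForms
  Literature.NumberTheory.EllipticCurves.Rank1Residual Literature.NumberTheory.EllipticCurves.Rank1Residual.Typed
  Summit.BirchSwinnertonDyer.Rank1Residual Summit.BirchSwinnertonDyer.Rank1Residual.X1.MuLambda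
  Summit.BirchSwinnertonDyer.Rank1Residual.Iwasawa Summit.BirchSwinnertonDyer.Rank1Residual.F1Sign2
  Summit.BirchSwinnertonDyer.Rank1Residual.Supersingular Summit.BirchSwinnertonDyer.Rank1Residual.Supersingular.BlindLever
  Summit.BirchSwinnertonDyer.BirchSwinnertonDyer.Theorems
  Summit.BirchSwinnertonDyer.BirchSwinnertonDyer.Theorems.AlignedTransportAtTwoTwinValueAnalytic
  Summit.BirchSwinnertonDyer.BirchSwinnertonDyer.Theorems.AlignedTransportAtTwoTwinValueParity
  Summit.BirchSwinnertonDyer.BirchSwinnertonDyer.Theorems.AlignedTransportAtTwoHalfDescent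
  Summit.BirchSwinnertonDyer.BirchSwinnertonDyer.Theorems.AlignedTransportAtTwoHalfDescentValues
  Summit.BirchSwinnertonDyer.BirchSwinnertonDyer.Theorems.AlignedTransportAtTwoHalfDescentAtTwo
  Summit.BirchSwinnertonDyer.BirchSwinnertonDyer.Theorems.AlignedTransportAtTwoHalfDescentTwistZero

/-! ## §1 Algebra: two `ι`-stable elements generate the same ideal iff they share ONE description `(μ, k, h)` -/

section Algebra

variable {p : ℕ} [hp : Fact p.Prime]

/-- ★★ **Same ideal ⟺ one common triple.** `F₁, F₂ ∈ Λ ∖ {0}`, `F₁` `ι`-stable with `F₁(0) ≠ 0`: `(F₁) = (F₂)` iff there are `μ, k, m`, a monic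
`h ∈ ℤ_p[Y]` of degree `m` and units `w₁, w₂` with `F_i = p^μ·(T+2)^k·h(γ+γ⁻¹)·w_i` (`i = 1, 2`). Reading: Mazur's main conjecture on the rank-0 cell
is `(μ_alg, k_alg, h_alg) = (μ_an, k_an, h_an)`. [cite: MazurTateTeitelbaum1986Invent, Ch. I §17] [cite: Washington1997, §7.1 (Weierstrass preparation, uniqueness)] -/
theorem span_eq_span_iff_exists_common_description {F₁ F₂ : IwasawaAlgebra p} (hF₁ : F₁ ≠ 0) (h0 : PowerSeries.constantCoeff F₁ ≠ 0)
    (hι : ∃ u : (IwasawaAlgebra p)ˣ, invol p F₁ = u * F₁) :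
    Ideal.span ({F₁} : Set (IwasawaAlgebra p)) = Ideal.span {F₂} ↔
      ∃ (μ k m : ℕ) (h : Polynomial ℤ_[p]) (w₁ w₂ : (IwasawaAlgebra p)ˣ), h.Monic ∧ h.natDegree = m ∧
        F₁ = PowerSeries.C ((p : ℤ_[p]) ^ μ) * ((X : IwasawaAlgebra p) + 2) ^ k *
          Polynomial.aeval (((1 : IwasawaAlgebra p) + X) + invol p (1 + X)) h * w₁ ∧
        F₂ = PowerSeries.C ((p : ℤ_[p]) ^ μ) * ((X : IwasawaAlgebra p) + 2) ^ k *
          Polynomial.aeval (((1 : IwasawaAlgebra p) + X) + invol p (1 + X)) h * w₂ := by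
  constructor
  · intro hspan
    obtain ⟨u, hu⟩ : ∃ u : (IwasawaAlgebra p)ˣ, F₁ * u = F₂ := by
      have hassoc : Associated F₁ F₂ := Ideal.span_singleton_eq_span_singleton.mp hspan
      exact hassoc
    obtain ⟨k, m, h, w, -, hmon, hn, hF⟩ := exists_eq_C_pow_mu_mul_X_add_two_pow_mul_aeval_mul_unit hF₁ h0 hι
    refine ⟨mu F₁, k, m, h, w, w * u, hmon, hn, hF, ?_⟩
    rw [← hu, Units.val_mul, ← mul_assoc, ← hF]
  · rintro ⟨μ, k, m, h, w₁, w₂, -, -, hF₁eq, hF₂eq⟩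
    apply Ideal.span_singleton_eq_span_singleton.mpr
    refine ⟨w₁⁻¹ * w₂, ?_⟩
    rw [hF₂eq, hF₁eq, Units.val_mul, mul_assoc, ← mul_assoc (w₁ : IwasawaAlgebra p), Units.mul_inv, one_mul]

end Algebra

/-! ## §2 The analytic triple `(μ_an, k_an, h_an)` of an even-branch lift -/

section Analytic

variable {W : WeierstrassCurve ℚ} [W.IsElliptic] [W.IsGloballyMinimal] [NeZero (W.conductorNorm ℤ)]
  {f : CuspForm (Gamma0 (W.conductorNorm ℤ)) 2}

/-- ★★★ **THE ANALYTIC HALF-DESCENT.** `W/ℚ` globally minimal, good at `2`, `f` its newform at the conductor level, `G ∈ Λ₂` an even-branch lift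
(`IsEvenBranchLiftAtTwo W f G`: `ι_Λ G = L₂(f, α)`) with `G(0) ≠ 0`. Then **`G = 2^{μ(G)}·(T+2)^k·h(γ + γ⁻¹)·w`**, `w ∈ Λˣ`, `h ∈ ℤ₂[Y]` monic,
`λ(G) = k + 2·deg h`: the analytic triple `(μ_an, k_an, h_an)` — `ι`-stability from the tree's functional equation, NO print binder.
[cite: GreenbergLNM1716, §1 (functional equation, pp. 67–68)] [cite: MazurTateTeitelbaum1986Invent, Ch. I §17]
[cite: GoreskyTai2017RealStructuresOrdinary, App. §16.2 Prop. 36 (p0036)] -/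
theorem exists_twistZero_realCounterpart_evenBranchLift (hgood : W.HasGoodReductionAtPrime 2) (hf : IsNewformOf W f) {G : IwasawaAlgebra 2}
    (hG : IsEvenBranchLiftAtTwo W f G) (hc0 : constantCoeff G ≠ 0) :
    ∃ (k m : ℕ) (h : Polynomial ℤ_[2]) (w : (IwasawaAlgebra 2)ˣ), lam G = k + 2 * m ∧ h.Monic ∧ h.natDegree = m ∧
      G = PowerSeries.C ((2 : ℤ_[2]) ^ mu G) * ((X : IwasawaAlgebra 2) + 2) ^ k *
        Polynomial.aeval (((1 : IwasawaAlgebra 2) + X) + invol 2 (1 + X)) h * w := by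
  have hG0 : G ≠ 0 := fun h0 ↦ hc0 (by rw [h0, map_zero])
  have hι := iotaStable_of_isEvenBranchLiftAtTwo hgood hf hG hG0
  have h := exists_eq_C_pow_mu_mul_X_add_two_pow_mul_aeval_mul_unit hG0 hc0 hι
  rwa [Nat.cast_ofNat] at h

/-- ★★ **The analytic real counterpart (no twist zero)**: if also `G(−2) ≠ 0` (the twin `α³G(−2) = S₈(f) ≠ 0`), then `λ(G) = 2m` and `∃! h` monic of
degree `m` with `P_G(X − 1) = X^m h(X + X⁻¹)` — and by `…HalfDescentValues`, `ord₂ G(0) = μ + ord₂ h(2)`, `ord₂ G(−2) = μ + ord₂ h(−2)`,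
`‖G(ζ₄ − 1)‖₂ = 2^{−μ}‖h(0)‖₂`, `‖G(ζ − 1)‖ = 2^{−μ}‖h(ζ + ζ⁻¹)‖` at every layer. [cite: GreenbergLNM1716, §1 (functional equation, pp. 67–68)]
[cite: GoreskyTai2017RealStructuresOrdinary, App. §16.2 Prop. 36 (p0036)] -/
theorem existsUnique_realCounterpart_evenBranchLift (hgood : W.HasGoodReductionAtPrime 2) (hf : IsNewformOf W f) {G : IwasawaAlgebra 2}
    (hG : IsEvenBranchLiftAtTwo W f G) (hc0 : constantCoeff G ≠ 0) (h2 : evalAt (-2 : ℤ_[2]) G ≠ 0) :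
    ∃ m : ℕ, lam G = 2 * m ∧ ∃! h : Polynomial ℤ_[2], (h.Monic ∧ h.natDegree = m) ∧
      ((pfree G).weierstrassDistinguished (red_pfree_ne_zero (fun h0 ↦ hc0 (by rw [h0, map_zero])))).comp
          (Polynomial.X - Polynomial.C 1) =
        ∑ j ∈ Finset.range (m + 1), Polynomial.C (h.coeff j) * Polynomial.X ^ (m - j) * (Polynomial.X ^ 2 + Polynomial.C 1) ^ j := by
  have hG0 : G ≠ 0 := fun h0 ↦ hc0 (by rw [h0, map_zero])
  have hι := iotaStable_of_isEvenBranchLiftAtTwo hgood hf hG hG0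
  obtain ⟨m, hm⟩ := even_lam_of_iotaStable' hG0 hι hc0 h2
  exact ⟨m, by rw [hm, two_mul], existsUnique_realCounterpart_of_lam hG0 hc0 hι (by rw [hm, two_mul])⟩

/-- ★★ **THE ANALYTIC LAYER-2 LAW.** `G` an even-branch lift with `G(0) ≠ 0 ≠ G(−2)`, `μ(G) = 0`, analytic weight `ord₂ G(0) = 2`, `ζ² = −1` in `ℂ₂`:
**`λ(G) = 2 ⟹ ‖G(ζ − 1)‖₂ = 1/2 ∧ 8 ∣ G(−2)`; `λ(G) ≥ 4 ⟹ ‖G(ζ − 1)‖₂ ≤ 1/4 ∧ ord₂ G(−2) = 2`** — the conductor-`16` row of the analytic tower is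
decided by `λ_an`. [cite: MazurTateTeitelbaum1986Invent, §I.14 and Ch. I §17] [cite: Washington1997, §7.1–7.2 and Thm. 7.3] -/
theorem layerTwo_law_evenBranchLift (hgood : W.HasGoodReductionAtPrime 2) (hf : IsNewformOf W f) {G : IwasawaAlgebra 2}
    (hG : IsEvenBranchLiftAtTwo W f G) (hc0 : constantCoeff G ≠ 0) (h2 : evalAt (-2 : ℤ_[2]) G ≠ 0) (hμ : mu G = 0)
    (hw : (constantCoeff G).valuation = 2) {ζ : ℂ_[2]} (hζ : ζ ^ 2 = -1) :
    (lam G = 2 → ‖∑' k, ((algebraMap ℚ_[2] ℂ_[2]).comp (algebraMap ℤ_[2] ℚ_[2])) (PowerSeries.coeff k G) * (ζ - 1) ^ k‖ = (2 : ℝ)⁻¹ ∧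
        (8 : ℤ_[2]) ∣ evalAt (-2 : ℤ_[2]) G) ∧
      (4 ≤ lam G → ‖∑' k, ((algebraMap ℚ_[2] ℂ_[2]).comp (algebraMap ℤ_[2] ℚ_[2])) (PowerSeries.coeff k G) * (ζ - 1) ^ k‖ ≤ ((2 : ℝ)⁻¹) ^ 2 ∧
        (evalAt (-2 : ℤ_[2]) G).valuation = 2) := by
  have hG0 : G ≠ 0 := fun h0 ↦ hc0 (by rw [h0, map_zero])
  obtain ⟨m, hlam, h, ⟨⟨hmon, hn⟩, hPh⟩, -⟩ := existsUnique_realCounterpart_evenBranchLift hgood hf hG hc0 h2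
  obtain ⟨hA, hB⟩ := layerTwo_law_of_weight_two hG0 hlam hmon hn hPh hc0 hμ hw hζ
  exact ⟨hA, fun h4 ↦ ⟨(hB h4).1, (hB h4).2.2⟩⟩

end Analytic

end Summit.BirchSwinnertonDyer.BirchSwinnertonDyer.Theorems.AlignedTransportAtTwoHalfDescentAnalytic

end
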